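import Mathlib
import Literature.Analysis.FluidPDE.CheskidovFriedlander2009.SteadyState
import HarnessLib

/-!
# Cheskidov–Friedlander 2009, §§3–4: the global attractor of the forced viscous dyadic model and
# the vanishing-viscosity limit of the mean energy dissipation (Kolmogorov's zeroth law for the
# dyadic model); the inviscid attractor of Cheskidov–Friedlander–Pavlović 2010

Statement layer (typed, page-confirmed) for the TIME-DEPENDENT part of
A. Cheskidov, S. Friedlander, *The vanishing viscosity limit for a dyadic model*, Physica D 238
(2009) 783–787 = arXiv:0810.3718v1 (locators below are arXiv v1 PDF pages), the companion of the
steady-state file `SteadyState.lean` in this directory (which reproduces §2 — positivity, decay,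
monotonicity Thm. 2.2, the steady energy identity and the injection floor — and records in its
module docstring that existence/uniqueness of the steady state, the global attractor of §3 and the
limit `ν → 0` of time averages, Thm. 4.2, are NOT reproduced there). The inviscid input of §4 is
A. Cheskidov, S. Friedlander, N. Pavlović, *An inviscid dyadic model of turbulence: the global
attractor*, Discrete Contin. Dyn. Syst. 26 (2010) 781–794 = arXiv:math/0610815v1 (PDF pages).

## The model and what is printed

* (1.2), p. 2: `d/dt a_j + ν2^{2j}a_j − 2^{c(j−1)}a_{j−1}² + 2^{cj}a_ja_{j+1} = f_j`, `j = 0,1,2,…`,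
  `a_{−1} = 0`, `c > 0`, force `f_0 > 0`, `f_j = 0` for `j > 0`; p. 3: `|a|² = Σ_j a_j²`
  (energy `E = ½|a|²`), `‖a‖²_{H^s} = Σ_j 2^{2js}a_j²`. (§3 (3.1), p. 7, reprints the model with the
  viscous term `ν2^{j}a_j` — a misprint for `ν2^{2j}a_j`, cf. (1.2), the `H¹` norm in (3.2) and the
  step (3.12) of the proof of Thm. 3.4; the file follows (1.2).) Standing in §§3–4: `c ∈ (3/2, 5/2]`,
  `ν > 0`, data `a(0) ∈ ℓ²`, `a_j(0) ≥ 0`.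
* Def. 3.1, p. 7: a solution on `[T,∞)` is an `ℓ²`-valued `a(t)` with `a_j ∈ C¹([T,∞))` satisfying
  the system for all `j` (here `T = 0`). Thms. 3.2/3.3, p. 7 (quoted from Cheskidov's theory of
  evolutionary systems): existence for non-negative `ℓ²` data with `a_j(t) ≥ 0`, and the energy
  inequality (3.2) `|a(t)|² + 2ν∫_{t₀}^t ‖a‖²_{H¹} ≤ |a(t₀)|² + 2∫_{t₀}^t (f,a)`. NOT typed here (they
  are Cheskidov 2008-type well-posedness statements; for `c ∈ (3/2, 2]` existence of strong solutions
  is the tree theorem `Literature.Barriers.NavierStokesRegularity.Dyadic.Cheskidov2008_thm44_holds`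
  in Cheskidov's normalisation `λ = 2^c`, `α = 1/c`, modes shifted by one).
* **Thm. 3.4**, p. 7 (global exponential attractor; "in particular, the fixed point is unique"):
  `|a(t) − α|² ≤ |a(0) − α|² e^{−2γνt}` for every `ℓ²` fixed point `α` and every solution with
  non-negative `ℓ²` datum, `γ ∈ (0,1)` the constant of Lemma 2.4, p. 6, which depends on
  `β = 2(1 − c/3)` only → `CheskidovFriedlander2009_globalAttractor` (the fixed point, like every
  solution of (3.1), is entrywise non-negative; necessary, `NegativeFixedPoint.lean`).
* §4, p. 9: `α^ν` = the (unique) fixed point at viscosity `ν ≥ 0`; for an inviscid solution `a⁰`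
  the anomalous dissipation rate is the non-negative Borel measure
  `ε_{a⁰} := (a⁰(t),f) − ½ d/dt|a⁰(t)|²`. **Thm. 4.1**, p. 9 ("proved in [CFP]"):
  `lim_{T→∞} T⁻¹∫₀ᵀ dε_{a⁰} =: ε_d > 0`. **Thm. 4.2**, p. 9: for solutions `a^ν` of the viscous model
  `lim_{T→∞} T⁻¹∫₀ᵀ ν‖a^ν(t)‖²_{H¹}dt → ε_d > 0` as `ν → 0`; proof pp. 9–10: the long-time limit
  exists and equals `(α^ν,f) = ν‖α^ν‖²_{H¹}`, and `(α^ν,f) → (α⁰,f) = α⁰₀f₀ =: ε_d`, where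
  `α⁰_j = 2^{−cj/3}2^{c/6}f₀^{1/2}` is the explicit inviscid fixed point (§2: `A_j ≡ 1`)
  → `CheskidovFriedlander2009_thm42`, `epsilonD`, `inviscidFixedPoint`.
* CFP 2010, (1.2) p. 1 = the model at `ν = 0`, `c = 5/2` (`λ = 2^{5/2}`), same force; Def. 3.1 p. 4
  (same solution notion); **Thm. 4.4**, p. 10: every solution with `a_j(0) ≥ 0` converges
  exponentially in `ℓ²` to the fixed point, `|b(t)|² ≤ |b(0)|²e^{−βt}` "for some universal constant
  `β > 0`" ((4.33): `β = (2 − λ^{3/8})/Σ_j λ^{1/3−2j/3}(j+1)`), printed under the normalisation (4.1)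
  `b_j = a_j − λ^{−j/3}`, i.e. `f₀ = λ^{−1/3} = 2^{−5/6}` → `CheskidovFriedlanderPavlovic2010_thm44`
  (stated for every `f₀ > 0` in the scaling-covariant form, see its docstring).

## Formal content (namespace `Literature.Analysis.FluidPDE.CheskidovFriedlander2009`)

Definitions with bodies: `rhs` (the vector field of (1.2), with `2^{cj}` written `(2^c)^j`),
`force`, `IsSolution` (Def. 3.1 on `[0,∞)`), `IsFixedPoint`, `normSq` (`|·|²`), `h1NormSq`
(`‖·‖²_{H¹}`, extended-real valued), `meanDissipation` (`T⁻¹∫₀ᵀ ν‖a(t)‖²_{H¹}dt`),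
`inviscidFixedPoint`, `epsilonD` (`ε_d = f₀α⁰₀ = 2^{c/6}f₀^{3/2}`). Proved: the explicit sequence
IS an `ℓ²` fixed point of the inviscid system (`isFixedPoint_inviscidFixedPoint`), fixed points are
(constant) solutions, `epsilonD_pos/_eq`, and the corollary `CheskidovFriedlander2009_thm42.floor`
(a dissipation floor uniform in small `ν`, the zeroth-law shape). Named facts stated here:
`CheskidovFriedlander2009_globalAttractor` (Thm. 3.4), `CheskidovFriedlander2009_thm42` (Thm. 4.2)
— both DISCHARGED downstream (`GlobalAttractor.lean`: `…_holds`) — and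
`CheskidovFriedlanderPavlovic2010_thm44`; the uniqueness clause of Thm. 3.4
(`CheskidovFriedlander2009_globalAttractor.fixedPoint_unique`) is proved from the first.

Not typed: Thms. 3.2/3.3 (see above); Thm. 4.1 as a separate fact (at `c = 5/2`, the case the
cited source CFP 2010 proves, it is a two-line consequence of `CheskidovFriedlanderPavlovic2010_thm44`
and the energy inequality — the Cesàro mean of `(a⁰(t),f) − ½ d/dt|a⁰|²` tends to
`(α⁰,f) = epsilonD` because `a⁰(t) → α⁰` in `ℓ²` — and CF 2009 state it for `c ∈ (3/2, 5/2]` by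
citation only); §5 (dissipation wavenumber, heuristic `∼`); CFP 2010 Thms. 4.2/4.3/4.5, Cor. 4.6
(blow-up in `H^{5/6}`) and §5 (evolutionary-system attractors).
-/

noncomputable section

open Filter Set MeasureTheory
open scoped Topology ENNReal BigOperators

namespace Literature.Analysis.FluidPDE.CheskidovFriedlander2009

/-! ### The time-dependent model (1.2) -/

/-- The vector field of the forced viscous dyadic model, Cheskidov–Friedlander 2009 (1.2):
`ȧ_j = −ν2^{2j}a_j + 2^{c(j−1)}a_{j−1}² − 2^{cj}a_ja_{j+1} + f_j` (`j ≥ 0`, `a_{−1} = 0`), with the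
coefficient `2^{cj}` written as `(2^c)^j`; at `j = 0` the transfer-in term is absent and
`2^{2·0} = (2^c)^0 = 1`. Parameters: intermittency exponent `c`, viscosity `ν ≥ 0` (`ν = 0` is the
inviscid model of Cheskidov–Friedlander–Pavlović), force `f`.
[cite: CheskidovFriedlander2009, §1 (1.2) p.2 and §3 (3.1) p.7] -/
def rhs (c ν : ℝ) (f : ℕ → ℝ) (a : ℕ → ℝ) : ℕ → ℝ
  | 0 => -(ν * a 0) - a 0 * a 1 + f 0
  | j + 1 => -(ν * (2 : ℝ) ^ (2 * (j + 1)) * a (j + 1)) + ((2 : ℝ) ^ c) ^ j * a j ^ 2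
      - ((2 : ℝ) ^ c) ^ (j + 1) * a (j + 1) * a (j + 2) + f (j + 1)

/-- The force of op. cit.: `f_0 = f₀ (> 0)` on the first shell and `f_j = 0` for `j > 0`.
[cite: CheskidovFriedlander2009, §1 (1.2) p.2] -/
def force (f₀ : ℝ) : ℕ → ℝ
  | 0 => f₀
  | _ + 1 => 0

/-- The first shell carries the force `f₀`. [cite: CheskidovFriedlander2009, §1 (1.2) p.2] -/
theorem force_zero (f₀ : ℝ) : force f₀ 0 = f₀ := rfl

/-- All other shells are unforced. [cite: CheskidovFriedlander2009, §1 (1.2) p.2] -/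
theorem force_succ (f₀ : ℝ) (j : ℕ) : force f₀ (j + 1) = 0 := rfl

/-- **Solutions** (Def. 3.1 with `T = 0`): an `ℓ²`-valued function `a(t)`, `t ∈ [0,∞)`, with each
`a_j ∈ C¹([0,∞))` satisfying (1.2) for all `j` — transcribed as: every mode has, at every `t ≥ 0`,
the derivative within `[0,∞)` prescribed by `rhs` (the right-hand side is then continuous, so each
`a_j` is `C¹`, indeed `C^∞`, as noted after Def. 3.1), and `Σ_j a_j(t)² < ∞` for every `t ≥ 0`.
Modes are indexed `a : ℕ → ℝ → ℝ` (mode, time). [cite: CheskidovFriedlander2009, Def 3.1 p.7] -/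
structure IsSolution (c ν : ℝ) (f : ℕ → ℝ) (a : ℕ → ℝ → ℝ) : Prop where
  /-- (1.2) holds for every mode at every `t ≥ 0` (one-sided at `t = 0`). -/
  hasDerivWithinAt : ∀ j : ℕ, ∀ t : ℝ, 0 ≤ t →
    HasDerivWithinAt (a j) (rhs c ν f (fun i => a i t) j) (Ici 0) t
  /-- `a(t) ∈ ℓ²` for every `t ≥ 0`. -/
  summable_sq : ∀ t : ℝ, 0 ≤ t → Summable fun j => a j t ^ 2

/-- The squared energy norm `|x|² = Σ_j x_j²` of op. cit. p. 3 (`E = ½|a|²`); junk value `0` off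
`ℓ²` (never met below: all sequences it is applied to are square-summable).
[cite: CheskidovFriedlander2009, §1 p.3] -/
def normSq (x : ℕ → ℝ) : ℝ := ∑' j, x j ^ 2

/-- The squared `H¹` norm `‖x‖²_{H¹} = Σ_j 2^{2j}x_j²` of op. cit. p. 3, valued in `[0,∞]` so that
divergence is visible. [cite: CheskidovFriedlander2009, §1 p.3] -/
def h1NormSq (x : ℕ → ℝ) : ℝ≥0∞ := ∑' j, ENNReal.ofReal ((2 : ℝ) ^ (2 * j) * x j ^ 2)

/-- The time-averaged energy dissipation rate `T⁻¹ ∫₀ᵀ ν‖a(t)‖²_{H¹} dt` of a trajectory up to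
time `T` (the quantity whose `T → ∞` limit Thm. 4.2 is about); the time integral is a lower
Lebesgue integral converted to a real number (junk `0` if infinite — excluded for the solutions of
§3 by the energy inequality (3.2)). [cite: CheskidovFriedlander2009, Thm 4.2 p.9] -/
def meanDissipation (ν : ℝ) (a : ℕ → ℝ → ℝ) (T : ℝ) : ℝ :=
  ν * (T⁻¹ * (∫⁻ t in Ioc (0 : ℝ) T, h1NormSq (fun j => a j t)).toReal)

/-- **Fixed points** (steady states) of (1.2) in the original variables: `α ∈ ℓ²` with
`rhs c ν f α ≡ 0` (§2 studies them in the rescaled variables `A_j = 2^{cj/3}2^{−c/6}f₀^{−1/2}α_j`,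
cf. `IsSteadyState` in `SteadyState.lean`; Thm. 3.4: "Let `α ∈ l²` be a fixed point of (3.1)").
[cite: CheskidovFriedlander2009, §2 p.4 and Thm 3.4 p.7] -/
def IsFixedPoint (c ν : ℝ) (f : ℕ → ℝ) (α : ℕ → ℝ) : Prop :=
  (Summable fun j => α j ^ 2) ∧ ∀ j, rhs c ν f α j = 0

/-- A fixed point, viewed as a constant trajectory, is a solution on `[0,∞)` (used in §4: "the
fixed point `α^ν` (since it is a regular solution) satisfies the energy equality").
[cite: CheskidovFriedlander2009, §4 p.9] -/
theorem IsFixedPoint.isSolution {c ν : ℝ} {f : ℕ → ℝ} {α : ℕ → ℝ} (h : IsFixedPoint c ν f α) :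
    IsSolution c ν f (fun j _ => α j) where
  hasDerivWithinAt j t _ := by
    have h0 : rhs c ν f (fun i => α i) j = 0 := h.2 j
    rw [h0]
    exact hasDerivWithinAt_const t (Ici 0) (α j)
  summable_sq _ _ := h.1

/-! ### The inviscid fixed point and the anomalous dissipation rate `ε_d` -/

/-- The explicit fixed point of the INVISCID model (`ν = 0`):
`α⁰_j = 2^{c/6} f₀^{1/2} 2^{−cj/3}` (§2: in the rescaled variables "there is a unique fixed point
with an explicit expression, namely `{A_j = 1}`"; CFP 2010 p. 2: `{2^{−5j/6}2^{5/12}√f₀}` at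
`c = 5/2`), written with the ratio `2^{−c/3}` raised to the `j`-th power.
[cite: CheskidovFriedlander2009, §2 p.4] [cite: CheskidovFriedlanderPavlovic2010, §1 p.2 (3)] -/
def inviscidFixedPoint (c f₀ : ℝ) (j : ℕ) : ℝ :=
  (2 : ℝ) ^ (c / 6) * Real.sqrt f₀ * ((2 : ℝ) ^ (-(c / 3))) ^ j

/-- The anomalous dissipation rate `ε_d := (α⁰, f) = α⁰₀ f₀` (last display of the proof of
Thm. 4.2, p. 10; CFP 2010 §6 p. 14: `ε̄ = a₀f₀ = 2^{5/12}f₀^{3/2}` at `c = 5/2`).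
[cite: CheskidovFriedlander2009, Thm 4.2 p.9–10] -/
def epsilonD (c f₀ : ℝ) : ℝ := f₀ * inviscidFixedPoint c f₀ 0

/-- `ε_d = 2^{c/6} f₀ √f₀ (= 2^{c/6} f₀^{3/2})`. [cite: CheskidovFriedlander2009, Thm 4.2 p.10] -/
theorem epsilonD_eq (c f₀ : ℝ) : epsilonD c f₀ = (2 : ℝ) ^ (c / 6) * f₀ * Real.sqrt f₀ := by
  simp only [epsilonD, inviscidFixedPoint, pow_zero, mul_one]
  ring

/-- `ε_d > 0` for `f₀ > 0` (the "`> 0`" of Thms. 4.1/4.2). [cite: CheskidovFriedlander2009, Thm 4.2 p.9] -/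
theorem epsilonD_pos (c : ℝ) {f₀ : ℝ} (hf : 0 < f₀) : 0 < epsilonD c f₀ := by
  rw [epsilonD_eq]
  have h2 : 0 < (2 : ℝ) ^ (c / 6) := Real.rpow_pos_of_pos two_pos _
  have hs : 0 < Real.sqrt f₀ := Real.sqrt_pos.mpr hf
  positivity

/-- `α⁰_j > 0`. [cite: CheskidovFriedlander2009, §2 p.4] -/
theorem inviscidFixedPoint_pos (c : ℝ) {f₀ : ℝ} (hf : 0 < f₀) (j : ℕ) :
    0 < inviscidFixedPoint c f₀ j := by
  unfold inviscidFixedPoint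
  have h1 : 0 < (2 : ℝ) ^ (c / 6) := Real.rpow_pos_of_pos two_pos _
  have h2 : 0 < (2 : ℝ) ^ (-(c / 3)) := Real.rpow_pos_of_pos two_pos _
  have hs : 0 < Real.sqrt f₀ := Real.sqrt_pos.mpr hf
  positivity

/-- The key identity behind the explicit fixed point: `2^c · (2^{−c/3})³ = 1`.
[cite: CheskidovFriedlander2009, §2 p.4] -/
theorem two_rpow_mul_ratio_pow_three (c : ℝ) :
    (2 : ℝ) ^ c * ((2 : ℝ) ^ (-(c / 3))) ^ 3 = 1 := by
  rw [← Real.rpow_natCast ((2 : ℝ) ^ (-(c / 3))) 3, ← Real.rpow_mul (by norm_num : (0 : ℝ) ≤ 2),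
    ← Real.rpow_add (by norm_num : (0 : ℝ) < 2)]
  have h : c + -(c / 3) * ((3 : ℕ) : ℝ) = 0 := by push_cast; ring
  rw [h, Real.rpow_zero]

/-- `(2^{c/6})² · 2^{−c/3} = 1`. [cite: CheskidovFriedlander2009, §2 p.4] -/
theorem two_rpow_sixth_sq_mul_ratio (c : ℝ) :
    ((2 : ℝ) ^ (c / 6)) ^ 2 * (2 : ℝ) ^ (-(c / 3)) = 1 := by
  rw [← Real.rpow_natCast ((2 : ℝ) ^ (c / 6)) 2, ← Real.rpow_mul (by norm_num : (0 : ℝ) ≤ 2),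
    ← Real.rpow_add (by norm_num : (0 : ℝ) < 2)]
  have h : c / 6 * ((2 : ℕ) : ℝ) + -(c / 3) = 0 := by push_cast; ring
  rw [h, Real.rpow_zero]

/-- The squares of the explicit fixed point form a geometric sequence:
`(α⁰_j)² = 2^{c/3} f₀ · (2^{−2c/3})^j`, written with `q = 2^{−c/3}`.
[cite: CheskidovFriedlander2009, §2 p.4] -/
theorem inviscidFixedPoint_sq (c : ℝ) {f₀ : ℝ} (hf : 0 ≤ f₀) (j : ℕ) :
    inviscidFixedPoint c f₀ j ^ 2 =
      ((2 : ℝ) ^ (c / 6)) ^ 2 * f₀ * (((2 : ℝ) ^ (-(c / 3))) ^ 2) ^ j := by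
  unfold inviscidFixedPoint
  rw [mul_pow, mul_pow, Real.sq_sqrt hf, ← pow_mul, ← pow_mul, mul_comm j 2]

/-- **The explicit sequence is an `ℓ²` fixed point of the inviscid system** (`ν = 0`, force
`f₀ ≥ 0` on the first shell, any `c > 0`): `α⁰₀α⁰₁ = f₀` and
`2^{cj}(α⁰_j)² = 2^{c(j+1)}α⁰_{j+1}α⁰_{j+2}` — the inviscid case `A_j ≡ 1` of (2.1).
[cite: CheskidovFriedlander2009, §2 (2.1) p.4] [cite: CheskidovFriedlanderPavlovic2010, Thm 5.4 p.14] -/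
theorem isFixedPoint_inviscidFixedPoint {c f₀ : ℝ} (hc : 0 < c) (hf : 0 ≤ f₀) :
    IsFixedPoint c 0 (force f₀) (inviscidFixedPoint c f₀) := by
  set p : ℝ := (2 : ℝ) ^ c with hp
  set q : ℝ := (2 : ℝ) ^ (-(c / 3)) with hq
  set K : ℝ := (2 : ℝ) ^ (c / 6) * Real.sqrt f₀ with hK
  have hpq : p * q ^ 3 = 1 := two_rpow_mul_ratio_pow_three c
  have hKq : K ^ 2 * q = f₀ := by
    rw [hK, mul_pow, Real.sq_sqrt hf, mul_right_comm, two_rpow_sixth_sq_mul_ratio, one_mul]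
  have hq0 : 0 ≤ q := (Real.rpow_pos_of_pos two_pos _).le
  have hq1 : q < 1 := by
    rw [hq]
    exact Real.rpow_lt_one_of_one_lt_of_neg (by norm_num) (by linarith)
  have hα : ∀ j, inviscidFixedPoint c f₀ j = K * q ^ j := fun j => rfl
  refine ⟨?_, ?_⟩
  · -- square-summability: a geometric series with ratio `q² < 1`
    have hgeom : Summable fun j : ℕ => (q ^ 2) ^ j :=
      summable_geometric_of_lt_one (by positivity) (by nlinarith)
    refine (hgeom.mul_left (K ^ 2)).congr fun j => ?_
    rw [hα]
    ring
  · intro j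
    cases j with
    | zero =>
      -- `−0·α₀ − α₀α₁ + f₀ = 0`
      simp only [rhs, force_zero, zero_mul, neg_zero, zero_sub, hα, pow_zero, mul_one, pow_one]
      nlinarith [hKq]
    | succ j =>
      simp only [rhs, force_succ, zero_mul, neg_zero, zero_add, add_zero, hα]
      -- `p^j K² q^{2j} − p^{j+1} K q^{j+1} K q^{j+2} = p^j K² q^{2j} (1 − p q³) = 0`
      have : p ^ j * (K * q ^ j) ^ 2 - p ^ (j + 1) * (K * q ^ (j + 1)) * (K * q ^ (j + 2)) =
          p ^ j * K ^ 2 * q ^ (2 * j) * (1 - p * q ^ 3) := by ring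
      rw [this, hpq, sub_self, mul_zero]

/-! ### §3: the global attractor (named fact) -/

/-- **Cheskidov–Friedlander 2009, Theorem 3.4** (the fixed point is the exponential global
attractor), faithful transcription, p. 7: "Let `α ∈ l²` be a fixed point of (3.1) for
`c ∈ (3/2, 5/2]` and `a(t)` be a solution with `a(0) ∈ l²` and `a_j(0) ≥ 0` for all `j`. Then
`|b(t)|² ≤ |b(0)|² e^{−2γνt}` (3.4)", `b = a − α` ((3.3)), `γ ∈ (0,1)` the constant of Lemma 2.4
(depending on `c` only, whence `∀ c ∃ γ ∀ ν, f₀, α, a`); standing hypotheses of §3: `ν > 0`,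
force `f₀ > 0` on the first shell, and — (3.1), p. 7: "the initial data is assumed to be
`a(0) ∈ l²`, `a_j(0) ≥ 0` for all `j`" — ALL solutions of §3, in particular the fixed point
(a constant solution), are entrywise non-negative (cf. Lemma 2.1 p. 4: `A_j > 0`).  This is the
hypothesis `∀ j, 0 ≤ α j` below (necessary: `NegativeFixedPoint.lean` exhibits a negative `ℓ²`
zero of the vector field at `c = 5/2`).  Named fact (proof: pp. 7–9, the
weighted energy estimate (3.5)–(3.12) using Thm. 2.2 and Lemma 2.4; its algebraic half is
formalised in `FluxRatioBound.lean` and `PerturbationEnergy.lean`).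
[cite: CheskidovFriedlander2009, Thm 3.4 p.7 and (3.1) p.7] -/
def CheskidovFriedlander2009_globalAttractor : Prop :=
  ∀ c : ℝ, 3 / 2 < c → c ≤ 5 / 2 → ∃ γ : ℝ, 0 < γ ∧ γ < 1 ∧
    ∀ ν f₀ : ℝ, 0 < ν → 0 < f₀ → ∀ α : ℕ → ℝ, IsFixedPoint c ν (force f₀) α → (∀ j, 0 ≤ α j) →
      ∀ a : ℕ → ℝ → ℝ, IsSolution c ν (force f₀) a → (∀ j, 0 ≤ a j 0) →
        ∀ t : ℝ, 0 ≤ t →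
          normSq (fun j => a j t - α j) ≤ normSq (fun j => a j 0 - α j) * Real.exp (-(2 * γ * ν * t))

/-- Uniqueness of the non-negative `ℓ²` fixed point — the "in particular, the fixed point is
unique" of Thm. 3.4 — from the faithful transcription: two non-negative fixed points coincide
(apply (3.4) to the constant solution `a ≡ α'`, let `t → ∞`).
[cite: CheskidovFriedlander2009, Thm 3.4 p.7] -/
theorem CheskidovFriedlander2009_globalAttractor.fixedPoint_unique
    (h : CheskidovFriedlander2009_globalAttractor) {c ν f₀ : ℝ} (hc : 3 / 2 < c) (hc' : c ≤ 5 / 2)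
    (hν : 0 < ν) (hf : 0 < f₀) {α α' : ℕ → ℝ} (hα : IsFixedPoint c ν (force f₀) α)
    (hαnn : ∀ j, 0 ≤ α j) (hα' : IsFixedPoint c ν (force f₀) α') (hpos : ∀ j, 0 ≤ α' j) :
    α' = α := by
  obtain ⟨γ, hγ0, -, hγ⟩ := h c hc hc'
  have hsol := hα'.isSolution
  have hb : ∀ t : ℝ, 0 ≤ t → normSq (fun j => α' j - α j) ≤
      normSq (fun j => α' j - α j) * Real.exp (-(2 * γ * ν * t)) :=
    fun t ht => hγ ν f₀ hν hf α hα hαnn (fun j _ => α' j) hsol hpos t ht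
  have hsum : Summable fun j => (α' j - α j) ^ 2 := by
    have h2 : ∀ j, (α' j - α j) ^ 2 ≤ 2 * α' j ^ 2 + 2 * α j ^ 2 := fun j => by
      nlinarith [sq_nonneg (α' j + α j)]
    exact Summable.of_nonneg_of_le (fun j => sq_nonneg _) h2
      ((hα'.1.mul_left 2).add (hα.1.mul_left 2))
  have hD0 : 0 ≤ normSq (fun j => α' j - α j) := tsum_nonneg fun j => sq_nonneg _
  have hD : normSq (fun j => α' j - α j) = 0 := by
    by_contra hne
    have hDpos : 0 < normSq (fun j => α' j - α j) := lt_of_le_of_ne hD0 (Ne.symm hne)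
    have h1 := hb 1 zero_le_one
    have hexp : Real.exp (-(2 * γ * ν * 1)) < 1 := by
      have : 0 < 2 * γ * ν := by positivity
      exact Real.exp_lt_one_iff.mpr (by linarith)
    have : normSq (fun j => α' j - α j) * Real.exp (-(2 * γ * ν * 1)) <
        normSq (fun j => α' j - α j) * 1 := mul_lt_mul_of_pos_left hexp hDpos
    linarith
  funext j
  have hj : (α' j - α j) ^ 2 = 0 := by
    have hle : (α' j - α j) ^ 2 ≤ normSq (fun j => α' j - α j) :=
      hsum.le_tsum j fun i _ => sq_nonneg _
    exact le_antisymm (by rw [hD] at hle; exact hle) (sq_nonneg _)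
  exact sub_eq_zero.mp (pow_eq_zero_iff (two_ne_zero) |>.mp hj)

/-! ### §4: dissipation anomaly (named facts and consequences) -/

/-- **Cheskidov–Friedlander–Pavlović 2010, Theorem 4.4** (the inviscid fixed point is the
exponential global attractor), p. 10: for the inviscid model (1.2) (`λ = 2^{5/2}`, i.e. `c = 5/2`,
`ν = 0`, force `f₀ > 0` on the first shell), "Let `a(t)` be a solution of (1.2) with `a_j(0) ≥ 0`.
Then `a(t)` exponentially converges in `l²` to the fixed point as `t → ∞`. More precisely,
`|b(t)|² ≤ |b(0)|² e^{−βt}` (4.30), for some universal constant `β > 0`" ((4.33):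
`β = (2 − λ^{3/8})/Σ_j λ^{1/3−2j/3}(j+1)`), `b = a − α⁰`. FIDELITY NOTE: §4 is written under the
normalisation (4.1) `b_j = a_j − λ^{−j/3}`, i.e. for the force `f₀ = λ^{−1/3} = 2^{−5/6}` (the
fixed point for a general `f₀` is `2^{−5j/6}2^{5/12}√f₀`, p. 2); the model's scaling
`a(t) ↦ κa(κt)`, `f ↦ κ²f` transports (4.30) to every `f₀ > 0` with the rate
`β(2^{5/6}f₀)^{1/2}`, which is the form stated here (literally (4.30) at `f₀ = 2^{−5/6}`).
Solutions: CFP Def. 3.1 p. 4 = `IsSolution (5/2) 0`. Named fact (proof pp. 6–10: the telescoping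
variables `d_j` and Thm. 4.2 there; not reproduced).
[cite: CheskidovFriedlanderPavlovic2010, Thm 4.4 p.10] -/
def CheskidovFriedlanderPavlovic2010_thm44 : Prop :=
  ∃ β : ℝ, 0 < β ∧ ∀ f₀ : ℝ, 0 < f₀ →
    ∀ a : ℕ → ℝ → ℝ, IsSolution (5 / 2) 0 (force f₀) a → (∀ j, 0 ≤ a j 0) →
      ∀ t : ℝ, 0 ≤ t →
        normSq (fun j => a j t - inviscidFixedPoint (5 / 2) f₀ j) ≤
          normSq (fun j => a j 0 - inviscidFixedPoint (5 / 2) f₀ j) *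
            Real.exp (-(β * Real.sqrt ((2 : ℝ) ^ (5 / 6 : ℝ) * f₀) * t))

/-- **Cheskidov–Friedlander 2009, Theorem 4.2** (the vanishing-viscosity limit of the mean energy
dissipation: Kolmogorov's zeroth law for the dyadic model), as printed, p. 9: "Let `a^ν(t)` be a
solution to the viscous dyadic model on `[0,∞)`. Then
`lim_{T→∞} T⁻¹∫₀ᵀ ν‖a^ν(t)‖²_{H¹}dt → ε_d > 0`, as `ν → 0`" — standing hypotheses of §§3–4:
`c ∈ (3/2, 5/2]`, force `f₀ > 0` on the first shell, data `a^ν(0) ∈ l²` with `a^ν_j(0) ≥ 0`; `ε_d`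
is identified at the end of the proof (p. 10) as `(α⁰,f) = α⁰₀f₀` (`epsilonD`). Transcription (the
literal reading of the displayed double limit): for every family `ν ↦ a^ν` of such solutions,
the long-time limits `L(ν) = lim_{T→∞} T⁻¹∫₀ᵀ ν‖a^ν‖²_{H¹}` exist for every `ν > 0` and
`L(ν) → ε_d` as `ν → 0⁺`. (The proof, pp. 9–10, shows more: `L(ν) = (α^ν,f) = ν‖α^ν‖²_{H¹}` for
the unique fixed point `α^ν`, whatever the datum; positivity `ε_d > 0` is `epsilonD_pos`.) Named
fact (proof: Thm. 3.4, the energy inequality (3.2) and Lemma 2.3; not reproduced).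
[cite: CheskidovFriedlander2009, Thm 4.2 p.9] -/
def CheskidovFriedlander2009_thm42 : Prop :=
  ∀ c : ℝ, 3 / 2 < c → c ≤ 5 / 2 → ∀ f₀ : ℝ, 0 < f₀ →
    ∀ a : ℝ → ℕ → ℝ → ℝ,
      (∀ ν, 0 < ν → IsSolution c ν (force f₀) (a ν) ∧ ∀ j, 0 ≤ a ν j 0) →
      ∃ L : ℝ → ℝ, (∀ ν, 0 < ν → Tendsto (meanDissipation ν (a ν)) atTop (𝓝 (L ν))) ∧
        Tendsto L (𝓝[>] 0) (𝓝 (epsilonD c f₀))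

/-- **The dissipation floor** (zeroth-law shape, from Thm. 4.2): for every family of solutions
`a^ν` with non-negative `ℓ²` data there are `ν₀ > 0` and `ε > 0` (namely any `ε < ε_d`) such that
for every `0 < ν < ν₀` the mean dissipation `T⁻¹∫₀ᵀ ν‖a^ν‖²_{H¹}` exceeds `ε` for all large `T`.
Proved from the named fact. [cite: CheskidovFriedlander2009, Thm 4.2 p.9] -/
theorem CheskidovFriedlander2009_thm42.floor (h : CheskidovFriedlander2009_thm42) {c f₀ : ℝ}
    (hc : 3 / 2 < c) (hc' : c ≤ 5 / 2) (hf : 0 < f₀) {a : ℝ → ℕ → ℝ → ℝ}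
    (ha : ∀ ν, 0 < ν → IsSolution c ν (force f₀) (a ν) ∧ ∀ j, 0 ≤ a ν j 0)
    {ε : ℝ} (hε : ε < epsilonD c f₀) :
    ∃ ν₀ : ℝ, 0 < ν₀ ∧ ∀ ν, 0 < ν → ν < ν₀ → ∀ᶠ T in atTop, ε < meanDissipation ν (a ν) T := by
  obtain ⟨L, hL, hlim⟩ := h c hc hc' f₀ hf a ha
  -- `L(ν) > ε` for all small `ν > 0`
  have hev : ∀ᶠ ν in 𝓝[>] (0 : ℝ), ε < L ν := hlim.eventually (lt_mem_nhds hε)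
  rw [eventually_nhdsWithin_iff, Metric.eventually_nhds_iff] at hev
  obtain ⟨δ, hδ, hδε⟩ := hev
  refine ⟨δ, hδ, fun ν hν hνδ => ?_⟩
  have hLν : ε < L ν := hδε (by simpa [Real.dist_eq, abs_of_pos hν] using hνδ) hν
  exact (hL ν hν).eventually (lt_mem_nhds hLν)

end Literature.Analysis.FluidPDE.CheskidovFriedlander2009

end
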